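/-
Copyright (c) 2026 the pub-hodgecm-mathlib formalisation cell (harness21).  Prover seat hodgecm-mathlib-B-p04 (g61), req618 STAGE 1a «FOUR-FRAME» squad, Track A TIER 2
for the tier-1 socket `U1_Frames` (assembler B-p04): the TYPE-2 STEP of A-2↓ (`stub_U1_exists_axisStable_vertex_dist_le`), BRICK 3 of 4, and the ONE-STEP LEMMA.  2026-09-03.
-/
import Literature.NumberTheory.Automorphic.UnitaryThreeFourFrameAxisUpStep          -- ★ p854737 (B-p04): BRICK 2 (up-step); brings ★ BRICK 1 p854730 (self-dual descent), DefectModuleShape, Types ∕ Dual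
import Literature.AlgebraicGeometry.PlaneCurves.CollineationCrossProduct            -- ★ `cross_mulVec` (`(Ga) × (Gb) = adj(G)ᵀ (a × b)`)
import HarnessLib

/-!
# (D-RAM) «FOUR-FRAME» road, unit (i), TIER 2, BRICK 3: the TYPE-2 STEP of A-2↓ — at a type-2 vertex `M`, `ϖ^{c+1}·π·M ⊆ M` forces `ϖ^c·π·M ⊆ M^♯`, so the up-step
# applies; with BRICK 1 this gives the ONE-STEP LEMMA at every vertex (Kottwitz 1986 §1; Jacobowitz 1962 §7–§8; Bruhat–Tits 1972 §10)

Topic `NumberTheory/Automorphic`; namespace `Literature.NumberTheory.Automorphic.UnitaryThreeFourFrame`.  THEOREMS ONLY; abstract currency (`K` any field with `Valued K ℤᵐ⁰`,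
`σ` an isometric involution with even-valued non-zero fixed elements, `ϖ` a uniformiser, `Φ₃ = (StdForm.antidiagonal 3).over K`, `π = frameProj σ f`, `N(f) ≠ 0`).
Cell `pub/hodgecm-mathlib`, crux H413; tier-1 socket `U1_Frames` stub U1-2 (A-2↓).  BRICK 1 = ★ `…AxisDescentSelfDual` (p854730), BRICK 2 = ★ `…AxisUpStep` (p854737).

THE MATHEMATICS.
* §1 THE LINE PROPERTY OF A TYPE-2 VERTEX («`M ∕ ϖM^♯` is a line»): `M = latt g` of type 2 (Gram `G` integral, `ϖG⁻¹` integral, `|det G| = |ϖ|²`); for `z, m ∈ M` with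
  `z ∉ ϖM^♯` there is `α ∈ 𝒪` with `m − αz ∈ ϖM^♯`.  In coordinates `x = g x′`: `x ∈ ϖM^♯ ⟺ G x′ ∈ ϖ𝒪³`; `adj G = det G · G⁻¹ ∈ ϖ·M₃(𝒪)`, so the 2×2 minors of
  `(Gz′ | Gm′) = adj(G)ᵀ(z′ × m′)` (★ `cross_mulVec`) lie in `ϖ𝒪`; a unit coordinate `(Gz′)_{i₀}` and `α := (Gm′)_{i₀} ∕ (Gz′)_{i₀}` do it.  No residue field.
* §2 AXIS PAIRINGS: `⟨x, πy⟩ = N⁻¹⟨f,y⟩⟨x,f⟩`, so `|⟨x,πy⟩|² = |⟨x,πx⟩|·|⟨y,πy⟩|` (DIAGONAL REDUCTION), and `⟨x, πx⟩` is `σ`-fixed.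
* §3 TYPE-2 DUAL STABILITY: `M` of type 2, `ϖ^{c+1}πM ⊆ M` ⇒ `ϖ^cπM ⊆ M^♯`.  By §2 it suffices that `|ϖ^c⟨m, πm⟩| ≤ 1` for `m ∈ M`; if not, `u := ϖ^{c+1}⟨m,πm⟩` is a UNIT
  (`|u| ≤ 1` as `z := ϖ^{c+1}πm ∈ M ⊆ M^♯`, `|u| > |ϖ|`), `⟨m, z⟩ = u`, `z ∉ ϖM^♯` (else `|u| ≤ |ϖ|`), so §1 gives `m = αz + ϖw′` (`w′ ∈ M^♯`) and
  `u = σα⟨z,z⟩ + σϖ⟨w′,z⟩` with `|⟨z,z⟩| = |ϖ|^{c+1}|u| < 1` (`π² = π`), `|σϖ⟨w′,z⟩| < 1`: contradiction.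
* §4 THE TYPE-2 STEP (§3 + BRICK 2) and THE ONE-STEP LEMMA at every vertex (type `0`: BRICK 1; type `2`: §4; ★ `type_eq_zero_or_two_of_isVertexLattice_three`): from a vertex
  `M` with `AxisStable ϖ π M (c+1)` to a vertex `L`, equal or adjacent to `M`, with `AxisStable ϖ π L c`.

HONEST LABEL: HC_CM is proved only modulo the 7 printed citations (2 remaining named inputs: hLiu418 = stmt-HodgeConjecture-24832, h413 = stmt-HodgeConjecture-24833) until rung 0
closes; `--supports stmt-HodgeConjecture-24833` helper; elementary lattice algebra.
-/

noncomputable section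

open scoped Valued WithZero Matrix MatrixGroups

namespace Literature.NumberTheory.Automorphic.UnitaryThreeFourFrame

open Literature.NumberTheory.Automorphic Literature.NumberTheory.Automorphic.HermitianLattice
  Literature.NumberTheory.Automorphic.UnitaryLatticeTree

variable {K : Type} [Field K] [Valued K ℤᵐ⁰]

/-! ## §0  Two facts about `ℤᵐ⁰` -/

/-- DISCRETENESS: `|ϖ| < a ≤ 1` with `|ϖ| = exp(−1)` forces `a = 1`. [cite: Serre1979, Ch. II §1] -/
theorem eq_one_of_exp_neg_one_lt_of_le_one {a : ℤᵐ⁰} (h1 : WithZero.exp (-1 : ℤ) < a) (h2 : a ≤ 1) : a = 1 := by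
  have ha : a ≠ 0 := by rintro rfl; exact not_lt_of_ge zero_le h1
  rw [← WithZero.exp_log ha] at h1 h2 ⊢
  rw [WithZero.exp_lt_exp] at h1
  rw [← WithZero.exp_zero, WithZero.exp_le_exp] at h2
  rw [← WithZero.exp_zero]; congr 1; omega

/-! ## §1  The line property of a type-2 vertex -/

/-- The adjugate of the Gram matrix of a type-2 vertex is divisible by `ϖ`: `adj G = det G · G⁻¹ = (det G ∕ ϖ)·(ϖG⁻¹)`. [cite: Jacobowitz1962, §7–§8] -/
theorem v_adjugate_apply_le {ϖ : K} (hϖ0 : ϖ ≠ 0) {G : Matrix (Fin 3) (Fin 3) K} (hGdet : IsUnit G.det) (hG' : IsIntMatrix (ϖ • G⁻¹))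
    (hdet : Valued.v G.det = Valued.v ϖ ^ 2) (k l : Fin 3) : Valued.v (G.adjugate k l) ≤ Valued.v ϖ := by
  have hvϖ0 : Valued.v ϖ ≠ 0 := (Valuation.ne_zero_iff _).2 hϖ0
  have hadj : G.adjugate = G.det • G⁻¹ := by rw [Matrix.inv_def, smul_smul, Ring.mul_inverse_cancel _ hGdet, one_smul]
  have hkl : G.adjugate k l = G.det * ϖ⁻¹ * ((ϖ • G⁻¹) k l) := by
    rw [hadj, Matrix.smul_apply, Matrix.smul_apply, smul_eq_mul, smul_eq_mul, mul_assoc, inv_mul_cancel_left₀ hϖ0]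
  rw [hkl, map_mul, map_mul, map_inv₀, hdet]
  calc Valued.v ϖ ^ 2 * (Valued.v ϖ)⁻¹ * Valued.v ((ϖ • G⁻¹) k l) ≤ Valued.v ϖ ^ 2 * (Valued.v ϖ)⁻¹ * 1 := mul_le_mul' le_rfl (hG' k l)
    _ = Valued.v ϖ := by rw [mul_one, pow_two, mul_assoc, mul_inv_cancel₀ hvϖ0, mul_one]

/-- The 2×2 minors of `(Gz′ | Gm′)` for integral `z′, m′` are divisible by `ϖ`: `(Gz′) × (Gm′) = adj(G)ᵀ (z′ × m′)`. [cite: Jacobowitz1962, §7–§8] -/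
theorem v_cross_mulVec_apply_le {ϖ : K} (hϖ0 : ϖ ≠ 0) {G : Matrix (Fin 3) (Fin 3) K} (hGdet : IsUnit G.det) (hG' : IsIntMatrix (ϖ • G⁻¹))
    (hdet : Valued.v G.det = Valued.v ϖ ^ 2) {z m : Fin 3 → K} (hz : ∀ i, Valued.v (z i) ≤ 1) (hm : ∀ i, Valued.v (m i) ≤ 1) (k : Fin 3) :
    Valued.v (((G *ᵥ z) ⨯₃ (G *ᵥ m)) k) ≤ Valued.v ϖ := by
  rw [Literature.AlgebraicGeometry.PlaneCurves.cross_mulVec, Matrix.mulVec, dotProduct]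
  refine Valuation.map_sum_le _ fun l _ => ?_
  rw [Matrix.transpose_apply, map_mul]
  have hzm : Valued.v ((z ⨯₃ m) l) ≤ 1 := by
    rw [cross_apply]
    fin_cases l
    · exact Valuation.map_sub_le _ (by rw [map_mul]; exact mul_le_one' (hz 1) (hm 2)) (by rw [map_mul]; exact mul_le_one' (hz 2) (hm 1))
    · exact Valuation.map_sub_le _ (by rw [map_mul]; exact mul_le_one' (hz 2) (hm 0)) (by rw [map_mul]; exact mul_le_one' (hz 0) (hm 2))
    · exact Valuation.map_sub_le _ (by rw [map_mul]; exact mul_le_one' (hz 0) (hm 1)) (by rw [map_mul]; exact mul_le_one' (hz 1) (hm 0))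
  calc Valued.v (G.adjugate l k) * Valued.v ((z ⨯₃ m) l) ≤ Valued.v ϖ * 1 := mul_le_mul' (v_adjugate_apply_le hϖ0 hGdet hG' hdet l k) hzm
    _ = Valued.v ϖ := mul_one _

omit [Valued K ℤᵐ⁰] in
/-- Every off-diagonal 2×2 minor of two vectors is `±` a component of their cross product. [cite: Jacobowitz1962, §7–§8] -/
theorem exists_minor_eq_cross_apply (y y' : Fin 3 → K) {i j : Fin 3} (hij : i ≠ j) :
    ∃ k : Fin 3, y i * y' j - y j * y' i = (y ⨯₃ y') k ∨ y i * y' j - y j * y' i = -((y ⨯₃ y') k) := by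
  fin_cases i <;> fin_cases j
  · exact absurd rfl hij
  · exact ⟨2, Or.inl (by simp [cross_apply])⟩
  · exact ⟨1, Or.inr (by simp [cross_apply])⟩
  · exact ⟨2, Or.inr (by simp [cross_apply])⟩
  · exact absurd rfl hij
  · exact ⟨0, Or.inl (by simp [cross_apply])⟩
  · exact ⟨1, Or.inl (by simp [cross_apply])⟩
  · exact ⟨0, Or.inr (by simp [cross_apply])⟩
  · exact absurd rfl hij

/-- THE LINE PROPERTY, COORDINATE FORM: `G` the Gram matrix of a type-2 vertex (`G`, `ϖG⁻¹` integral, `|det G| = |ϖ|²`), `z′, m′ ∈ 𝒪³`, `Gz′ ∉ ϖ𝒪³` ⇒ there is `α ∈ 𝒪` with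
`G(m′ − αz′) ∈ ϖ𝒪³`. [cite: Jacobowitz1962, §7–§8] [cite: BruhatTits1972, §10] -/
theorem exists_sub_smul_mulVec_small {ϖ : K} (hϖ : Valued.v ϖ = WithZero.exp (-1 : ℤ)) {G : Matrix (Fin 3) (Fin 3) K} (hGdet : IsUnit G.det)
    (hGint : IsIntMatrix G) (hG' : IsIntMatrix (ϖ • G⁻¹)) (hdet : Valued.v G.det = Valued.v ϖ ^ 2) {z m : Fin 3 → K}
    (hz : ∀ i, Valued.v (z i) ≤ 1) (hm : ∀ i, Valued.v (m i) ≤ 1) (hzϖ : ¬ ∀ i, Valued.v ((G *ᵥ z) i) ≤ Valued.v ϖ) :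
    ∃ α : K, Valued.v α ≤ 1 ∧ ∀ i, Valued.v ((G *ᵥ (m - α • z)) i) ≤ Valued.v ϖ := by
  have hϖ0 : ϖ ≠ 0 := fun h => by rw [h, map_zero] at hϖ; exact WithZero.zero_ne_coe hϖ
  push Not at hzϖ
  obtain ⟨i₀, hi₀⟩ := hzϖ
  set y : Fin 3 → K := G *ᵥ z with hy
  set y' : Fin 3 → K := G *ᵥ m with hy'
  have hyint : ∀ i, Valued.v (y i) ≤ 1 := fun i => by
    rw [hy, Matrix.mulVec, dotProduct]
    exact Valuation.map_sum_le _ fun l _ => by rw [map_mul]; exact mul_le_one' (hGint i l) (hz l)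
  have hy'int : ∀ i, Valued.v (y' i) ≤ 1 := fun i => by
    rw [hy', Matrix.mulVec, dotProduct]
    exact Valuation.map_sum_le _ fun l _ => by rw [map_mul]; exact mul_le_one' (hGint i l) (hm l)
  -- the pivot is a unit
  have hu : Valued.v (y i₀) = 1 := eq_one_of_exp_neg_one_lt_of_le_one (hϖ ▸ hi₀) (hyint i₀)
  have hu0 : y i₀ ≠ 0 := fun h => by rw [h, map_zero] at hu; exact zero_ne_one hu
  refine ⟨y' i₀ / y i₀, by rw [map_div₀, hu, div_one]; exact hy'int i₀, fun i => ?_⟩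
  have hcoord : (G *ᵥ (m - (y' i₀ / y i₀) • z)) i = (y i₀ * y' i - y i * y' i₀) / y i₀ := by
    rw [Matrix.mulVec_sub, Matrix.mulVec_smul, Pi.sub_apply, Pi.smul_apply, smul_eq_mul, ← hy, ← hy']
    field_simp
  rw [hcoord, map_div₀, hu, div_one]
  by_cases hi : i₀ = i
  · subst hi; rw [mul_comm, sub_self, map_zero]; exact zero_le
  · obtain ⟨k, hk | hk⟩ := exists_minor_eq_cross_apply y y' hi
    · rw [hk]; exact v_cross_mulVec_apply_le hϖ0 hGdet hG' hdet hz hm k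
    · rw [hk, Valuation.map_neg]; exact v_cross_mulVec_apply_le hϖ0 hGdet hG' hdet hz hm k

/-- **THE LINE PROPERTY OF A TYPE-2 VERTEX** («`M ∕ ϖM^♯` is a line»): `M` a vertex of type 2, `z, m ∈ M`, `z ∉ ϖM^♯` ⇒ `m − αz ∈ ϖM^♯` for some `α ∈ 𝒪`.
[cite: Jacobowitz1962, §7–§8] [cite: BruhatTits1972, §10] -/
theorem exists_sub_smul_mem_scaleLattice_dualLatt_of_type_two {σ : K →+* K} (hvσ : ∀ a, Valued.v (σ a) = Valued.v a) {ϖ : K}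
    (hϖ : Valued.v ϖ = WithZero.exp (-1 : ℤ)) {M : Submodule 𝒪[K] (Fin 3 → K)} (hM : IsVertexLattice σ ϖ ((StdForm.antidiagonal 3).over K) 2 M)
    {z m : Fin 3 → K} (hz : z ∈ M) (hm : m ∈ M) (hzϖ : z ∉ scaleLattice ϖ (dualLatt σ ((StdForm.antidiagonal 3).over K) M)) :
    ∃ α : K, Valued.v α ≤ 1 ∧ m - α • z ∈ scaleLattice ϖ (dualLatt σ ((StdForm.antidiagonal 3).over K) M) := by
  obtain ⟨g, rfl, hGint, hG', hdet⟩ := hM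
  have hϖ0 : ϖ ≠ 0 := fun h => by rw [h, map_zero] at hϖ; exact WithZero.zero_ne_coe hϖ
  have hvϖ0 : Valued.v ϖ ≠ 0 := (Valuation.ne_zero_iff _).2 hϖ0
  have hH : IsUnit ((StdForm.antidiagonal 3).over K).det := isUnit_iff_ne_zero.2 fun h0 => by
    have h1 := v_det_antidiagonal_three (K := K); rw [h0, map_zero] at h1; exact zero_ne_one h1
  have hgdet : IsUnit (g : Matrix (Fin 3) (Fin 3) K).det := Matrix.isUnits_det_units g
  have hCdet : IsUnit (((g : Matrix (Fin 3) (Fin 3) K).map σ)ᵀ * (StdForm.antidiagonal 3).over K).det := by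
    rw [Matrix.det_mul]; exact (isUnit_det_transpose_map σ hgdet).mul hH
  have hGdet : IsUnit (formCongr σ g ((StdForm.antidiagonal 3).over K)).det := by
    rw [formCongr, Matrix.det_mul]; exact hCdet.mul hgdet
  -- membership in `ϖM^♯` in coordinates: `x ∈ ϖM^♯ ⟺ G(g⁻¹x) ∈ ϖ𝒪³`
  have key : ∀ x : Fin 3 → K, x ∈ scaleLattice ϖ (dualLatt σ ((StdForm.antidiagonal 3).over K) (latt (g : Matrix (Fin 3) (Fin 3) K))) ↔
      ∀ i, Valued.v ((formCongr σ g ((StdForm.antidiagonal 3).over K) *ᵥ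
        ((g : Matrix (Fin 3) (Fin 3) K)⁻¹ *ᵥ x)) i) ≤ Valued.v ϖ := by
    intro x
    have hGx : formCongr σ g ((StdForm.antidiagonal 3).over K) *ᵥ ((g : Matrix (Fin 3) (Fin 3) K)⁻¹ *ᵥ x) =
        (((g : Matrix (Fin 3) (Fin 3) K).map σ)ᵀ * (StdForm.antidiagonal 3).over K) *ᵥ x := by
      rw [formCongr, Matrix.mulVec_mulVec, Matrix.mul_assoc, Matrix.mul_nonsing_inv _ hgdet, Matrix.mul_one]
    rw [mem_scaleLattice_iff hϖ0, dualLatt_latt_eq σ hvσ hH hgdet, mem_latt_iff_of_isUnit (Matrix.isUnit_nonsing_inv_det_iff.2 hCdet),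
      Matrix.nonsing_inv_nonsing_inv _ hCdet, mem_stdLattice, hGx, Matrix.mulVec_smul]
    refine forall_congr' fun i => ?_
    rw [Pi.smul_apply, smul_eq_mul, map_mul, map_inv₀, inv_mul_le_iff₀ (zero_lt_iff.2 hvϖ0), mul_one]
  -- coordinates of `z`, `m`
  have hz' := (mem_latt_iff_of_isUnit hgdet z).1 hz
  have hm' := (mem_latt_iff_of_isUnit hgdet m).1 hm
  rw [mem_stdLattice] at hz' hm'
  have hzϖ' : ¬ ∀ i, Valued.v ((formCongr σ g ((StdForm.antidiagonal 3).over K) *ᵥ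
      ((g : Matrix (Fin 3) (Fin 3) K)⁻¹ *ᵥ z)) i) ≤ Valued.v ϖ := fun h => hzϖ ((key z).2 h)
  obtain ⟨α, hα, hαi⟩ := exists_sub_smul_mulVec_small hϖ hGdet hGint hG' hdet hz' hm' hzϖ'
  refine ⟨α, hα, (key _).2 ?_⟩
  rwa [Matrix.mulVec_sub, Matrix.mulVec_smul]

/-! ## §2  Axis pairings: `⟨x, πy⟩ = N⁻¹⟨f,y⟩⟨x,f⟩` and the diagonal reduction -/

omit [Valued K ℤᵐ⁰] in
/-- `⟨x, π y⟩ = N(f)⁻¹ · ⟨f, y⟩ · ⟨x, f⟩`. [cite: Jacobowitz1962, §4] -/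
theorem pairing_frameProj_mulVec_right (σ : K →+* K) (f x y : Fin 3 → K) :
    pairing σ ((StdForm.antidiagonal 3).over K) x (frameProj σ f *ᵥ y) =
      (pairing σ ((StdForm.antidiagonal 3).over K) f f)⁻¹ * pairing σ ((StdForm.antidiagonal 3).over K) f y *
        pairing σ ((StdForm.antidiagonal 3).over K) x f := by
  rw [frameProj_mulVec, map_smul, smul_eq_mul]

/-- `|⟨x, πy⟩| = |⟨y, πx⟩|`. [cite: Jacobowitz1962, §4] -/
theorem v_pairing_frameProj_comm {σ : K →+* K} (hσσ : ∀ a, σ (σ a) = a) (hvσ : ∀ a, Valued.v (σ a) = Valued.v a) (f x y : Fin 3 → K) :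
    Valued.v (pairing σ ((StdForm.antidiagonal 3).over K) x (frameProj σ f *ᵥ y)) =
      Valued.v (pairing σ ((StdForm.antidiagonal 3).over K) y (frameProj σ f *ᵥ x)) := by
  have hJ := map_antidiagonal_three_over_apply_eq (K := K) σ
  rw [pairing_frameProj_mulVec_right, pairing_frameProj_mulVec_right, map_mul, map_mul, map_mul, map_mul,
    v_pairing_comm_of_hermitian hvσ hσσ hJ y f, v_pairing_comm_of_hermitian hvσ hσσ hJ x f]
  ac_rfl

/-- DIAGONAL REDUCTION: `|⟨x, πy⟩|² = |⟨x, πx⟩|·|⟨y, πy⟩|`. [cite: Jacobowitz1962, §4] -/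
theorem v_pairing_frameProj_mul_self {σ : K →+* K} (hσσ : ∀ a, σ (σ a) = a) (hvσ : ∀ a, Valued.v (σ a) = Valued.v a) (f x y : Fin 3 → K) :
    Valued.v (pairing σ ((StdForm.antidiagonal 3).over K) x (frameProj σ f *ᵥ y)) * Valued.v (pairing σ ((StdForm.antidiagonal 3).over K) x (frameProj σ f *ᵥ y)) =
      Valued.v (pairing σ ((StdForm.antidiagonal 3).over K) x (frameProj σ f *ᵥ x)) *
        Valued.v (pairing σ ((StdForm.antidiagonal 3).over K) y (frameProj σ f *ᵥ y)) := by
  have hJ := map_antidiagonal_three_over_apply_eq (K := K) σ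
  rw [pairing_frameProj_mulVec_right, pairing_frameProj_mulVec_right, pairing_frameProj_mulVec_right]
  simp only [map_mul, v_pairing_comm_of_hermitian hvσ hσσ hJ y f, v_pairing_comm_of_hermitian hvσ hσσ hJ x f]
  ac_rfl

/-! ## §3  Type-2 dual stability: `ϖ^{c+1}πM ⊆ M ⇒ ϖ^cπM ⊆ M^♯` -/

/-- At a type-2 vertex `M` with `ϖ^{c+1}πM ⊆ M`: `|ϖ^c⟨m, πm⟩| ≤ 1` for every `m ∈ M` (§1 + §2; the argument is in the module docstring).
[cite: Kottwitz1986BaseChangeUnits, §1 pp. 240–241] [cite: Jacobowitz1962, §7–§8] -/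
theorem v_pairing_frameProj_self_le_one_of_type_two {σ : K →+* K} (hσσ : ∀ a, σ (σ a) = a) (hvσ : ∀ a, Valued.v (σ a) = Valued.v a) {ϖ : K}
    (hϖ : Valued.v ϖ = WithZero.exp (-1 : ℤ)) {f : Fin 3 → K} (hf : pairing σ ((StdForm.antidiagonal 3).over K) f f ≠ 0)
    {M : Submodule 𝒪[K] (Fin 3 → K)} (hM : IsVertexLattice σ ϖ ((StdForm.antidiagonal 3).over K) 2 M) {c : ℕ}
    (hc : M.map ((Matrix.toLin' (ϖ ^ (c + 1) • frameProj σ f)).restrictScalars 𝒪[K]) ≤ M) {m : Fin 3 → K} (hm : m ∈ M) :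
    Valued.v (ϖ ^ c * pairing σ ((StdForm.antidiagonal 3).over K) m (frameProj σ f *ᵥ m)) ≤ 1 := by
  have hϖ0 : ϖ ≠ 0 := fun h => by rw [h, map_zero] at hϖ; exact WithZero.zero_ne_coe hϖ
  have hϖ1 : Valued.v ϖ < 1 := by rw [hϖ, ← WithZero.exp_zero, WithZero.exp_lt_exp]; omega
  have hϖ1' : Valued.v ϖ ≤ 1 := hϖ1.le
  have hJ := map_antidiagonal_three_over_apply_eq (K := K) σ
  have hMdual : M ≤ dualLatt σ ((StdForm.antidiagonal 3).over K) M := le_dualLatt_of_isVertexLattice hvσ hM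
  by_contra hlt
  rw [not_le] at hlt
  -- `z := ϖ^{c+1}πm ∈ M`, `u := ⟨m, z⟩ = ϖ^{c+1}⟨m, πm⟩` is a unit
  obtain ⟨z, hz_def⟩ : ∃ z, z = (ϖ ^ (c + 1) • frameProj σ f) *ᵥ m := ⟨_, rfl⟩
  have hzM : z ∈ M := hz_def ▸ hc ⟨m, hm, rfl⟩
  obtain ⟨u, hu_def⟩ : ∃ u, u = ϖ ^ (c + 1) * pairing σ ((StdForm.antidiagonal 3).over K) m (frameProj σ f *ᵥ m) := ⟨_, rfl⟩
  have hmz : pairing σ ((StdForm.antidiagonal 3).over K) m z = u := by rw [hz_def, hu_def, Matrix.smul_mulVec, map_smul, smul_eq_mul]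
  have hu1 : Valued.v u ≤ 1 := by rw [← hmz]; exact (mem_dualLatt σ _ M _).1 (hMdual hzM) m hm
  have hu2 : WithZero.exp (-1 : ℤ) < Valued.v u := by
    rw [hu_def, pow_succ', mul_assoc, map_mul, hϖ]
    calc (WithZero.exp (-1 : ℤ) : ℤᵐ⁰) = WithZero.exp (-1 : ℤ) * 1 := (mul_one _).symm
      _ < WithZero.exp (-1 : ℤ) * Valued.v (ϖ ^ c * pairing σ ((StdForm.antidiagonal 3).over K) m (frameProj σ f *ᵥ m)) :=
          mul_lt_mul_of_pos_left hlt WithZero.exp_pos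
  have hu : Valued.v u = 1 := eq_one_of_exp_neg_one_lt_of_le_one hu2 hu1
  -- `z ∉ ϖM^♯`
  have hzϖ : z ∉ scaleLattice ϖ (dualLatt σ ((StdForm.antidiagonal 3).over K) M) := by
    intro h
    rw [mem_scaleLattice_iff hϖ0] at h
    have h1 := (mem_dualLatt σ _ M _).1 h m hm
    rw [map_smul, smul_eq_mul, hmz, map_mul, map_inv₀, hu, mul_one, hϖ, ← WithZero.exp_neg, ← WithZero.exp_zero, WithZero.exp_le_exp] at h1
    omega
  -- the line property: `m = αz + ϖw′`, `w′ ∈ M^♯`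
  obtain ⟨α, hα, hw⟩ := exists_sub_smul_mem_scaleLattice_dualLatt_of_type_two hvσ hϖ hM hzM hm hzϖ
  rw [mem_scaleLattice_iff hϖ0] at hw
  have hsplit : u = σ α * pairing σ ((StdForm.antidiagonal 3).over K) z z +
      σ ϖ * pairing σ ((StdForm.antidiagonal 3).over K) (ϖ⁻¹ • (m - α • z)) z := by
    have hm_eq : m = α • z + ϖ • (ϖ⁻¹ • (m - α • z)) := by rw [smul_smul, mul_inv_cancel₀ hϖ0, one_smul, add_sub_cancel]
    rw [← hmz]
    conv_lhs => rw [hm_eq]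
    rw [LinearMap.map_add₂, LinearMap.map_smulₛₗ₂, LinearMap.map_smulₛₗ₂, smul_eq_mul, smul_eq_mul]
  -- `⟨z, z⟩ = σ(ϖ^{c+1})·u`
  have hzz : pairing σ ((StdForm.antidiagonal 3).over K) z z = σ (ϖ ^ (c + 1)) * u := by
    rw [hz_def, hu_def, Matrix.smul_mulVec, LinearMap.map_smulₛₗ₂, map_smul, smul_eq_mul, smul_eq_mul, pairing_frameProj_mulVec hσσ f,
      Matrix.mulVec_mulVec, frameProj_mul_self σ hf]
  -- both summands are `< 1`, contradiction with `|u| = 1`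
  have hA : Valued.v (σ α * pairing σ ((StdForm.antidiagonal 3).over K) z z) ≤ Valued.v ϖ := by
    rw [map_mul, hvσ, hzz, map_mul, hvσ, map_pow, hu, mul_one, pow_succ]
    calc Valued.v α * (Valued.v ϖ ^ c * Valued.v ϖ) ≤ 1 * (1 * Valued.v ϖ) :=
          mul_le_mul' hα (mul_le_mul' (pow_le_one₀ zero_le hϖ1') le_rfl)
      _ = Valued.v ϖ := by rw [one_mul, one_mul]
  have hB : Valued.v (σ ϖ * pairing σ ((StdForm.antidiagonal 3).over K) (ϖ⁻¹ • (m - α • z)) z) ≤ Valued.v ϖ := by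
    rw [map_mul, hvσ, v_pairing_comm_of_hermitian hvσ hσσ hJ]
    calc Valued.v ϖ * Valued.v (pairing σ ((StdForm.antidiagonal 3).over K) z (ϖ⁻¹ • (m - α • z))) ≤ Valued.v ϖ * 1 :=
          mul_le_mul' le_rfl ((mem_dualLatt σ _ M _).1 hw z hzM)
      _ = Valued.v ϖ := mul_one _
  have hle : Valued.v u ≤ Valued.v ϖ := by rw [hsplit]; exact Valuation.map_add_le _ hA hB
  rw [hu] at hle
  exact (lt_irrefl _) (hϖ1.trans_le hle)

/-- **TYPE-2 DUAL STABILITY**: at a type-2 vertex `M`, `ϖ^{c+1}·π·M ⊆ M ⇒ ϖ^c·π·M ⊆ M^♯` (§3 pointwise bound + §2 diagonal reduction).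
[cite: Kottwitz1986BaseChangeUnits, §1 pp. 240–241] [cite: Jacobowitz1962, §7–§8] -/
theorem map_le_dualLatt_of_type_two {σ : K →+* K} (hσσ : ∀ a, σ (σ a) = a) (hvσ : ∀ a, Valued.v (σ a) = Valued.v a) {ϖ : K}
    (hϖ : Valued.v ϖ = WithZero.exp (-1 : ℤ)) {f : Fin 3 → K} (hf : pairing σ ((StdForm.antidiagonal 3).over K) f f ≠ 0)
    {M : Submodule 𝒪[K] (Fin 3 → K)} (hM : IsVertexLattice σ ϖ ((StdForm.antidiagonal 3).over K) 2 M) {c : ℕ}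
    (hc : M.map ((Matrix.toLin' (ϖ ^ (c + 1) • frameProj σ f)).restrictScalars 𝒪[K]) ≤ M) :
    M.map ((Matrix.toLin' (ϖ ^ c • frameProj σ f)).restrictScalars 𝒪[K]) ≤ dualLatt σ ((StdForm.antidiagonal 3).over K) M := by
  rintro _ ⟨m', hm', rfl⟩
  rw [mem_dualLatt]
  intro y hy
  change Valued.v (pairing σ ((StdForm.antidiagonal 3).over K) y ((ϖ ^ c • frameProj σ f) *ᵥ m')) ≤ 1
  rw [Matrix.smul_mulVec, map_smul, smul_eq_mul]
  refine le_one_of_mul_self_le_one ?_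
  have h1 := v_pairing_frameProj_self_le_one_of_type_two hσσ hvσ hϖ hf hM hc hy
  have h2 := v_pairing_frameProj_self_le_one_of_type_two hσσ hvσ hϖ hf hM hc hm'
  rw [map_mul] at h1 h2 ⊢
  calc Valued.v (ϖ ^ c) * Valued.v (pairing σ ((StdForm.antidiagonal 3).over K) y (frameProj σ f *ᵥ m')) *
        (Valued.v (ϖ ^ c) * Valued.v (pairing σ ((StdForm.antidiagonal 3).over K) y (frameProj σ f *ᵥ m')))
      = Valued.v (ϖ ^ c) * Valued.v (pairing σ ((StdForm.antidiagonal 3).over K) y (frameProj σ f *ᵥ y)) *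
        (Valued.v (ϖ ^ c) * Valued.v (pairing σ ((StdForm.antidiagonal 3).over K) m' (frameProj σ f *ᵥ m'))) := by
          rw [mul_mul_mul_comm, v_pairing_frameProj_mul_self hσσ hvσ f y m', ← mul_mul_mul_comm]
    _ ≤ 1 := mul_le_one' h1 h2

/-! ## §4  The type-2 step and the one-step lemma at every vertex -/

/-- **THE TYPE-2 STEP**: from a TYPE-2 vertex `M` with `AxisStable ϖ π M (c+1)` to a vertex `L ⊇ M` (so `L = M` or `L` is adjacent to `M`) with `AxisStable ϖ π L c` —
§3 feeds BRICK 2 (★ `exists_axisStable_vertex_ge_of_map_le_dualLatt`). [cite: Kottwitz1986BaseChangeUnits, §1 pp. 240–241] [cite: BruhatTits1972, §10] -/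
theorem exists_axisStable_vertex_ge_of_type_two {σ : K →+* K} (hσσ : ∀ a, σ (σ a) = a) (hvσ : ∀ a, Valued.v (σ a) = Valued.v a) {ϖ : K}
    (hϖ : Valued.v ϖ = WithZero.exp (-1 : ℤ)) (heven : ∀ x : K, σ x = x → x ≠ 0 → ∃ n : ℤ, Valued.v x = WithZero.exp (2 * n))
    {f : Fin 3 → K} (hf : pairing σ ((StdForm.antidiagonal 3).over K) f f ≠ 0)
    {M : Submodule 𝒪[K] (Fin 3 → K)} (hM : IsVertexLattice σ ϖ ((StdForm.antidiagonal 3).over K) 2 M) {c : ℕ}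
    (hc : AxisStable ϖ (frameProj σ f) M (c + 1)) :
    ∃ (L : Submodule 𝒪[K] (Fin 3 → K)) (hL : IsVertex σ ϖ ((StdForm.antidiagonal 3).over K) L), AxisStable ϖ (frameProj σ f) L c ∧ M ≤ L ∧
      (L = M ∨ (latticeGraph σ ϖ ((StdForm.antidiagonal 3).over K)).Adj ⟨M, ⟨2, hM⟩⟩ ⟨L, hL⟩) := by
  obtain ⟨L, hL, hTL, hML, -⟩ :=
    exists_axisStable_vertex_ge_of_map_le_dualLatt hσσ hvσ hϖ heven hf ⟨2, hM⟩ (map_le_dualLatt_of_type_two hσσ hvσ hϖ hf hM hc)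
  refine ⟨L, hL, hTL, hML, ?_⟩
  rcases eq_or_lt_of_le hML with h | h
  · exact Or.inl h.symm
  · exact Or.inr ((latticeGraph_adj_iff σ ϖ _ _ _).2 (Or.inl h))

/-- **THE ONE-STEP LEMMA OF A-2↓ (at every vertex)**: `σ` an isometric involution whose non-zero fixed elements have even valuation, `ϖ` a uniformiser, `π = π_f`
(`N(f) ≠ 0`); from any VERTEX `M` of the lattice graph of `(K³, Φ₃)` with `AxisStable ϖ π M (c+1)` there is a vertex `L`, EQUAL OR ADJACENT to `M`, with
`AxisStable ϖ π L c` — type `0`: BRICK 1 (descent inside `M`); type `2`: the type-2 step (ascent inside `M^♯`); every vertex has type `0` or `2`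
(★ `type_eq_zero_or_two_of_isVertexLattice_three`). [cite: Kottwitz1986BaseChangeUnits, §1 pp. 240–241] [cite: BruhatTits1972, §10] [cite: Serre1980Trees, II.1.1] -/
theorem exists_axisStable_vertex_eq_or_adj {σ : K →+* K} (hσσ : ∀ a, σ (σ a) = a) (hvσ : ∀ a, Valued.v (σ a) = Valued.v a) {ϖ : K}
    (hϖ : Valued.v ϖ = WithZero.exp (-1 : ℤ)) (heven : ∀ x : K, σ x = x → x ≠ 0 → ∃ n : ℤ, Valued.v x = WithZero.exp (2 * n))
    {f : Fin 3 → K} (hf : pairing σ ((StdForm.antidiagonal 3).over K) f f ≠ 0)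
    {M : Submodule 𝒪[K] (Fin 3 → K)} (hM : IsVertex σ ϖ ((StdForm.antidiagonal 3).over K) M) {c : ℕ} (hc : AxisStable ϖ (frameProj σ f) M (c + 1)) :
    ∃ (L : Submodule 𝒪[K] (Fin 3 → K)) (hL : IsVertex σ ϖ ((StdForm.antidiagonal 3).over K) L), AxisStable ϖ (frameProj σ f) L c ∧
      (L = M ∨ (latticeGraph σ ϖ ((StdForm.antidiagonal 3).over K)).Adj ⟨M, hM⟩ ⟨L, hL⟩) := by
  obtain ⟨d, hMd⟩ := id hM
  rcases type_eq_zero_or_two_of_isVertexLattice_three hvσ hϖ v_det_antidiagonal_three hMd with rfl | rfl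
  · obtain ⟨N, hN, hTN, -, h⟩ := exists_axisStable_eq_or_adj_of_isSelfDualLattice hσσ hvσ hϖ hf hMd hc
    exact ⟨N, hN, hTN, h⟩
  · obtain ⟨L, hL, hTL, -, h⟩ := exists_axisStable_vertex_ge_of_type_two hσσ hvσ hϖ heven hf hMd hc
    exact ⟨L, hL, hTL, h⟩

end Literature.NumberTheory.Automorphic.UnitaryThreeFourFrame
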